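import Literature.AlgebraicGeometry.HodgeTheory.RationalHodgeClasses
import Literature.AlgebraicTopology.SingularHomology.CohomologyFiniteness
import HarnessLib

/-!
# Rational classes: `Hᵏ(Y; ℚ) ⊗ ℂ → Hᵏ(Y; ℂ)` is injective

Family `hodge`, layer `Literature/AlgebraicGeometry/HodgeTheory`. Companion to
`RationalHodgeClasses` (`HodgeTheory.IsRationalClass c`: the class `c ∈ Hᵏ(Y; ℂ)` is represented
by a singular cocycle with values in `ℚ ⊆ ℂ`). PROVED here, for every topological space `Y` and
every degree `k`: **a finite family of rational classes which satisfies no non-trivial rational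
linear relation is `ℂ`-linearly independent** (`linearIndependent_of_isRationalClass`, with the
`iff` form `linearIndependent_iff_of_isRationalClass`). Equivalently, the comparison map
`Hᵏ(Y; ℚ) ⊗_ℚ ℂ → Hᵏ(Y; ℂ)` is injective — the injectivity half of "`Hᵏ(X, ℂ) = Hᵏ(X, ℚ) ⊗ ℂ`"
(Voisin I, §7.1.1; Hatcher, §3.1, Thm. 3.2 with p. 198: over a field `F`,
`Hⁿ(X; F) ≅ Hom_F(Hₙ(X; F), F)`, and `Hom(Hₙ, ℚ) ⊗ ℂ ↪ Hom(Hₙ, ℂ)`), which holds WITHOUT any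
finiteness assumption on `Y`. First consumer: the barrier catalogue
`Literature/Barriers/HodgeConjecture` (Grothendieck 1969: `ℚ`-ranks of spaces of rational classes
versus complex dimensions of their spans; the named fact
`rationalClasses_basis_of_isSmoothProjective` of `GeneralizedHodgeTrivialReasonsEvenRankProofs`,
whose linear-independence clause is thereby a theorem).

## The proof (cochain level, Hatcher §3.1)

Let `Σⱼ gⱼ [zⱼ] = 0` in `Hᵏ(Y; ℂ)` with `gⱼ ∈ ℂ` and `ℚ`-valued cocycles `zⱼ`. Then `Σⱼ gⱼ zⱼ = δβ`
for a `ℂ`-valued cochain `β` (exactness at the cocycles, `exists_toCocycles_of_π_eq_zero`). For a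
`ℚ`-linear functional `φ : ℂ → ℚ`, post-composition of cochains with the additive map
`f = (ℚ ↪ ℂ) ∘ φ` commutes with the coboundary — an alternating sum of face evaluations —
(`cochain_d_postcomp`), and `f (Σⱼ gⱼ zⱼ(σ)) = Σⱼ φ(gⱼ) zⱼ(σ)` because the `zⱼ(σ)` are rational; so
`Σⱼ φ(gⱼ) zⱼ = δ(f ∘ β)` is a coboundary, `Σⱼ φ(gⱼ) [zⱼ] = 0` is a RATIONAL relation, and
`φ(gⱼ) = 0`. As the `ℚ`-linear functionals separate the points of `ℂ`
(`Module.forall_dual_apply_eq_zero_iff`), `gⱼ = 0`.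

## References

* A. Hatcher, *Algebraic Topology* (2002), §3.1 (cochains, `δ`), Thm. 3.2 and p. 198.
* C. Voisin, *Hodge Theory and Complex Algebraic Geometry I* (2002), §7.1.1.
-/

noncomputable section

open CategoryTheory Limits

universe u

namespace Literature.AlgebraicGeometry.HodgeTheory

section HodgeTheory

open Literature.AlgebraicTopology.SingularHomology

variable {Y : Type u} [TopologicalSpace Y]

/-! ### Cochain-level lemmas -/

/-- Post-composition of complex singular `n`-cochains with an additive map `f : ℂ → ℂ` commutes
with the coboundary `δ : Cⁿ → Cⁿ⁺¹`, an alternating sum of face evaluations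
(`singularCochainComplex.d_apply`). [cite: HatcherAT2002, §3.1] -/
theorem cochain_d_postcomp_succ (f : ℂ →+ ℂ) (n : ℕ) (ψ : SingularSimplex Y n → ℂ) :
    (singularCochainComplex ℂ ℂ Y).d n (n + 1) (fun σ ↦ f (ψ σ)) =
      fun σ ↦ f ((singularCochainComplex ℂ ℂ Y).d n (n + 1) ψ σ) := by
  refine singularCochainComplex.ext fun σ ↦ ?_
  simp only [singularCochainComplex.d_apply, map_sum]
  refine Finset.sum_congr rfl fun i _ ↦ ?_
  rcases neg_one_pow_eq_or ℂ (i : ℕ) with h | h <;> simp [h]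

/-- The same in arbitrary degrees `i, j` (when `j ≠ i + 1` both differentials vanish).
[cite: HatcherAT2002, §3.1] -/
theorem cochain_d_postcomp (f : ℂ →+ ℂ) (i j : ℕ) (ψ : SingularSimplex Y i → ℂ) :
    (singularCochainComplex ℂ ℂ Y).d i j (fun σ ↦ f (ψ σ)) =
      fun σ ↦ f ((singularCochainComplex ℂ ℂ Y).d i j ψ σ) := by
  by_cases hij : (ComplexShape.up ℕ).Rel i j
  · have : j = i + 1 := by simpa [ComplexShape.up_Rel] using hij.symm
    subst this
    exact cochain_d_postcomp_succ f i ψ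
  · refine singularCochainComplex.ext fun σ ↦ ?_
    rw [(singularCochainComplex ℂ ℂ Y).shape i j hij]
    change (0 : SingularSimplex Y j → ℂ) σ = f ((0 : SingularSimplex Y j → ℂ) σ)
    simp

/-- **Exactness at the cocycles:** a complex `k`-cocycle whose cohomology class vanishes is the
coboundary of a cochain of the previous degree (`Hᵏ = Zᵏ / Bᵏ`; `HomologicalComplex.homologyIsCokernel`
read on elements of `ModuleCat`). [cite: HatcherAT2002, §3.1] -/
theorem exists_toCocycles_of_π_eq_zero {k : ℕ} (w : singularCochainComplex.cocycles ℂ ℂ Y k)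
    (hw : singularCohomology.π ℂ ℂ Y k w = 0) :
    ∃ β : (singularCochainComplex ℂ ℂ Y).X ((ComplexShape.up ℕ).prev k),
      singularCochainComplex.toCocycles ℂ ℂ Y _ k β = w := by
  set K := singularCochainComplex ℂ ℂ Y
  set i := (ComplexShape.up ℕ).prev k
  let S : ShortComplex (ModuleCat ℂ) :=
    ShortComplex.mk (K.toCycles i k) (K.homologyπ k) (K.toCycles_comp_homologyπ i k)
  have hS : S.Exact := ShortComplex.exact_of_g_is_cokernel S (K.homologyIsCokernel i k rfl)
  exact (ShortComplex.moduleCat_exact_iff S).1 hS w hw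

/-- Evaluation at a simplex is additive over finite sums of cochains (cochains are functions,
`cochainFun`). [folklore] -/
theorem cochainFun_sum_apply {k : ℕ} {ι : Type*} (s : Finset ι)
    (c : ι → (singularCochainComplex ℂ ℂ Y).X k) (σ : SingularSimplex Y k) :
    cochainFun ℂ ℂ k (∑ j ∈ s, c j) σ = ∑ j ∈ s, cochainFun ℂ ℂ k (c j) σ := by
  rw [map_sum, Finset.sum_apply]

/-- Evaluation at a simplex is homogeneous. [folklore] -/
theorem cochainFun_smul_apply {k : ℕ} (a : ℂ) (c : (singularCochainComplex ℂ ℂ Y).X k)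
    (σ : SingularSimplex Y k) : cochainFun ℂ ℂ k (a • c) σ = a * cochainFun ℂ ℂ k c σ := by
  rw [map_smul, Pi.smul_apply, smul_eq_mul]

/-! ### Rational relations versus complex relations -/

/-- **`Hᵏ(Y; ℚ) ⊗ ℂ → Hᵏ(Y; ℂ)` is injective, in the language of rational classes.** For any
topological space `Y` and any finite family `b` of RATIONAL classes of `Hᵏ(Y; ℂ)`
(`IsRationalClass`): if `b` satisfies no non-trivial rational linear relation
(`Σⱼ qⱼ bⱼ = 0` with `qⱼ ∈ ℚ` forces `q = 0`), then `b` is `ℂ`-linearly independent. Proof in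
the module docstring (a complex relation is a coboundary `δβ`; apply the `ℚ`-linear functionals
`ℂ → ℚ` to `β`). This is the injectivity half of `Hᵏ(X, ℚ) ⊗ ℂ = Hᵏ(X, ℂ)` (Voisin I, §7.1.1;
Hatcher, Thm. 3.2 with p. 198), valid without finiteness hypotheses.
[cite: HatcherAT2002, §3.1 Thm. 3.2 and p. 198] [cite: VoisinHodgeI2002, §7.1.1] -/
theorem linearIndependent_of_isRationalClass {k : ℕ} {ι : Type*} [Fintype ι]
    {b : ι → singularCohomology ℂ ℂ Y k} (hb : ∀ j, IsRationalClass (b j))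
    (hind : ∀ q : ι → ℚ, ∑ j, ((q j : ℚ) : ℂ) • b j = 0 → q = 0) :
    LinearIndependent ℂ b := by
  classical
  rw [Fintype.linearIndependent_iff]
  intro g hg
  choose z hz hzq using hb
  choose q hq using hzq
  set K := singularCochainComplex ℂ ℂ Y with hK
  set i := (ComplexShape.up ℕ).prev k with hi
  have hqv : ∀ j σ, cochainFun ℂ ℂ k (singularCochainComplex.iCocycles ℂ ℂ Y k (z j)) σ =
      algebraMap ℚ ℂ (q j σ) := fun j σ ↦ (hq j σ).symm
  -- the cocycle `w = Σ gⱼ zⱼ` has zero class, hence is a coboundary `δβ`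
  set w : singularCochainComplex.cocycles ℂ ℂ Y k := ∑ j, g j • z j with hwdef
  have hw : singularCohomology.π ℂ ℂ Y k w = 0 := by
    rw [hwdef, map_sum]
    simp only [map_smul, hz]
    exact hg
  obtain ⟨β, hβ⟩ := exists_toCocycles_of_π_eq_zero w hw
  have hdβ : K.d i k β = singularCochainComplex.iCocycles ℂ ℂ Y k w := by
    rw [← hβ]
    change _ = (K.toCycles i k ≫ K.iCycles k) β
    rw [HomologicalComplex.toCycles_i]
  have hwσ : ∀ σ, cochainFun ℂ ℂ k (singularCochainComplex.iCocycles ℂ ℂ Y k w) σ =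
      ∑ j, g j * algebraMap ℚ ℂ (q j σ) := by
    intro σ
    rw [hwdef, map_sum, cochainFun_sum_apply]
    refine Finset.sum_congr rfl fun j _ ↦ ?_
    rw [map_smul, cochainFun_smul_apply, hqv]
  -- test with a `ℚ`-linear functional `φ : ℂ → ℚ`
  refine fun j ↦ (Module.forall_dual_apply_eq_zero_iff ℚ (g j)).1 fun φ ↦ ?_
  let f : ℂ →+ ℂ := (algebraMap ℚ ℂ).toAddMonoidHom.comp φ.toAddMonoidHom
  have hf : ∀ x, f x = algebraMap ℚ ℂ (φ x) := fun x ↦ rfl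
  -- the rational combination `w' = Σ φ(gⱼ) zⱼ` has values `f ∘ (values of w)`
  set w' : singularCochainComplex.cocycles ℂ ℂ Y k := ∑ j, ((φ (g j) : ℚ) : ℂ) • z j with hw'def
  have hw'σ : ∀ σ, cochainFun ℂ ℂ k (singularCochainComplex.iCocycles ℂ ℂ Y k w') σ =
      f (cochainFun ℂ ℂ k (singularCochainComplex.iCocycles ℂ ℂ Y k w) σ) := by
    intro σ
    rw [hw'def, map_sum, cochainFun_sum_apply, hwσ, map_sum f]
    refine Finset.sum_congr rfl fun j _ ↦ ?_
    rw [map_smul, cochainFun_smul_apply, hqv, hf,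
      show g j * (algebraMap ℚ ℂ) (q j σ) = (q j σ) • g j by rw [Algebra.smul_def, mul_comm],
      map_smul]
    simp only [eq_ratCast, smul_eq_mul, Rat.cast_mul]
    ring
  -- hence `w' = δ (f ∘ β)` is a coboundary and its class, a rational relation, vanishes
  have hdβ' : K.d i k (fun σ ↦ f (cochainFun ℂ ℂ i β σ)) =
      singularCochainComplex.iCocycles ℂ ℂ Y k w' := by
    have h1 := cochain_d_postcomp f i k (cochainFun ℂ ℂ i β)
    refine singularCochainComplex.ext fun σ ↦ ?_
    have h2 := congrFun h1 σ
    change cochainFun ℂ ℂ k (K.d i k (fun σ ↦ f (cochainFun ℂ ℂ i β σ))) σ =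
      cochainFun ℂ ℂ k (singularCochainComplex.iCocycles ℂ ℂ Y k w') σ
    rw [hw'σ, ← hdβ]
    exact h2
  have hw'co : w' = singularCochainComplex.toCocycles ℂ ℂ Y i k
      (fun σ ↦ f (cochainFun ℂ ℂ i β σ)) := by
    apply (ModuleCat.mono_iff_injective (singularCochainComplex.iCocycles ℂ ℂ Y k)).1 inferInstance
    change _ = (K.toCycles i k ≫ K.iCycles k) _
    rw [HomologicalComplex.toCycles_i, hdβ']
  have hπw' : singularCohomology.π ℂ ℂ Y k w' = 0 := by
    rw [hw'co]
    change (K.toCycles i k ≫ K.homologyπ k) _ = 0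
    rw [HomologicalComplex.toCycles_comp_homologyπ]
    rfl
  have hrel : ∑ j, ((φ (g j) : ℚ) : ℂ) • b j = 0 := by
    rw [← hπw', hw'def, map_sum]
    simp only [map_smul, hz]
  exact congrFun (hind (fun j ↦ φ (g j)) hrel) j

/-- For a finite family of rational classes, `ℂ`-linear independence is EQUIVALENT to the
absence of non-trivial rational relations (the converse direction is the injectivity of
`ℚ → ℂ`). [cite: HatcherAT2002, §3.1 Thm. 3.2 and p. 198] -/
theorem linearIndependent_iff_of_isRationalClass {k : ℕ} {ι : Type*} [Fintype ι]
    {b : ι → singularCohomology ℂ ℂ Y k} (hb : ∀ j, IsRationalClass (b j)) :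
    LinearIndependent ℂ b ↔ ∀ q : ι → ℚ, ∑ j, ((q j : ℚ) : ℂ) • b j = 0 → q = 0 := by
  refine ⟨fun h q hq ↦ ?_, linearIndependent_of_isRationalClass hb⟩
  funext j
  have := Fintype.linearIndependent_iff.1 h (fun j ↦ ((q j : ℚ) : ℂ)) hq j
  exact_mod_cast this

/-- In particular the complex span of such a family has dimension its cardinality: the
`ℚ`-rank of a space of rational classes is the complex dimension of its span.
[cite: VoisinHodgeI2002, §7.1.1] -/
theorem finrank_span_of_isRationalClass {k : ℕ} {ι : Type*} [Fintype ι]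
    {b : ι → singularCohomology ℂ ℂ Y k} (hb : ∀ j, IsRationalClass (b j))
    (hind : ∀ q : ι → ℚ, ∑ j, ((q j : ℚ) : ℂ) • b j = 0 → q = 0) :
    Module.finrank ℂ (Submodule.span ℂ (Set.range b)) = Fintype.card ι :=
  finrank_span_eq_card (linearIndependent_of_isRationalClass hb hind)

end HodgeTheory

end Literature.AlgebraicGeometry.HodgeTheory

end
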